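import Summits.AtomisticToContinuum.FouriersLaw.Theorems.PhononMeanFreePathHarmonicCoherentPersistenceDampedFlow
import Summits.AtomisticToContinuum.FouriersLaw.Theorems.IncoherentChannel.Negative.HarmonicWick
import Summits.AtomisticToContinuum.FouriersLaw.Theorems.CoherentDephasing.Negative.KillSwitches

/-!
# HarmonicCoherentPersistence: the coherent channel of the harmonic chain does not close

Closes item `stmt-AtomisticToContinuum-11814` (route `PhononMeanFreePath`, support; the calibration
/ negative side of crux `CoherentDephasing` at the integrable corner `lam = β = 0`):

  `HarmonicCoherentPersistence : ∀ ω₂ γ > 0, ∀ T > 0, (∀ N, r_N² ∈ L¹(0,∞)) ∧ ¬ (N ∫₀^∞ r_N² → 0)`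

for the pinned HARMONIC chain `pinnedChain ω₂ 0 0 γ` with `N + 1` sites, where
`r_N(t) = ∫ p₀ · (K_t p_N) dμ_T` is typed with the CONSTRUCTED Langevin transition kernels and the
Gibbs measure. Assembly:

* `r_N(t) = T · G_N(t⁺)` (`IncoherentChannel.Negative.HarmonicWick.harmonic_rN_eq_response`, the
  standing disprover's classical fluctuation–dissipation identity: superposition for the constructed
  flow + Stein's identity for the Gibbs measure), `G_N` the deterministic impulse response of `p_N`
  to a unit kick on `p₀`;
* `G_N² ∈ L¹(0,∞)` and `∫₀^∞ G_N² = c_{N+1}/(2γ²)` (`integrableOn_response_sq`,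
  `integral_response_sq` of the support file `PhononMeanFreePathHarmonicCoherentPersistenceDampedFlow`:
  finite-time Lyapunov identity + LaSalle + energy balance at the last site), `c_n = fluxCoeff ω₂ γ n`
  the Rieder–Lebowitz–Lieb / Nakazawa flux coefficient of the tree (`HarmonicChainCovariance`,
  `HarmonicChainFlux`);
* so `∫₀^∞ r_N² = T² c_{N+1}/(2γ²) → T² c_∞/(2γ²) > 0` (`tendsto_fluxCoeff`, `fluxLimit_pos`),
  whereas `N ∫ r_N² → 0` would force `∫ r_N² → 0`.

So `2γ²T⁻² ∫₀^∞ r_N²` is exactly the ballistic RLL conductance `c_{N+1}`, confirming the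
normalisation of the coherent channel in `BoundaryKubo`/`CoherentDephasing`, and anharmonicity is
load-bearing for the crux (`CoherentDephasing/Negative/LoadBearing`).
-/

noncomputable section

open MeasureTheory Filter Topology Set
open scoped NNReal
open Literature.MathematicalPhysics.KineticTheory.HeatConduction
open Summit.AtomisticToContinuum.FouriersLaw.Theses.PhononMeanFreePath
open Summit.AtomisticToContinuum.FouriersLaw.Theorems.CoherentDephasing.Negative.KillSwitches
open Summit.AtomisticToContinuum.FouriersLaw.Theorems.IncoherentChannel.Negative.HarmonicWick

namespace Summit.AtomisticToContinuum.FouriersLaw.Theorems.HarmonicCoherentPersistence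

section Harmonic

variable {ω₂ γ : ℝ} (hω : 0 < ω₂) (hγ : 0 < γ) {T : ℝ} (hT : 0 < T)
include hω hγ hT

/-- On `t > 0`: `r_N(t)² = T² G_N(t)²`. [folklore] -/
theorem harmonic_pairCorr_sq_eqOn (N : ℕ) :
    EqOn (fun t : ℝ => (∫ z, z.2 0 * (∫ y, y.2 (Fin.last N)
        ∂((pinnedChain ω₂ 0 0 γ).transitionKernel (N + 1) T T t.toNNReal z))
        ∂((pinnedChain ω₂ 0 0 γ).gibbsMeasure (N + 1) T)) ^ 2)
      (fun t : ℝ => T ^ 2 * ((pinnedChain ω₂ 0 0 γ).chainFlow (N + 1)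
        ((0, Pi.single 0 1) : PhaseSpace (N + 1)) 0 t).2 (Fin.last N) ^ 2) (Ioi 0) := by
  intro t ht
  simp only
  rw [harmonic_rN_eq_response hω hγ.le hT N t, Real.coe_toNNReal t (le_of_lt ht)]
  ring

/-- **`r_N² ∈ L¹(0, ∞)` for every `N`** (harmonic chain, `ω₂, γ, T > 0`). [folklore] -/
theorem harmonic_integrableOn_pairCorr_sq (N : ℕ) :
    IntegrableOn (fun t : ℝ => (∫ z, z.2 0 * (∫ y, y.2 (Fin.last N)
        ∂((pinnedChain ω₂ 0 0 γ).transitionKernel (N + 1) T T t.toNNReal z))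
        ∂((pinnedChain ω₂ 0 0 γ).gibbsMeasure (N + 1) T)) ^ 2) (Ioi 0) :=
  IntegrableOn.congr_fun ((integrableOn_response_sq hω hγ N).const_mul (T ^ 2))
    (harmonic_pairCorr_sq_eqOn hω hγ hT N).symm measurableSet_Ioi

/-- **`∫₀^∞ r_N² = T² c_{N+1} / (2γ²)`** for `N ≥ 1`: the coherent channel `2γ²T⁻² ∫₀^∞ r_N²` of
the harmonic chain IS the Rieder–Lebowitz–Lieb conductance `c_{N+1} = fluxCoeff ω₂ γ (N+1)`.
[cite: RiederLebowitzLieb1967, results (i)-(ii) as restated in RoyDhar2008 §1] -/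
theorem harmonic_integral_pairCorr_sq {N : ℕ} (hN : 1 ≤ N) :
    ∫ t in Ioi (0 : ℝ), (∫ z, z.2 0 * (∫ y, y.2 (Fin.last N)
        ∂((pinnedChain ω₂ 0 0 γ).transitionKernel (N + 1) T T t.toNNReal z))
        ∂((pinnedChain ω₂ 0 0 γ).gibbsMeasure (N + 1) T)) ^ 2 =
      T ^ 2 * fluxCoeff ω₂ γ (N + 1) / (2 * γ ^ 2) := by
  rw [setIntegral_congr_fun measurableSet_Ioi (harmonic_pairCorr_sq_eqOn hω hγ hT N),
    integral_const_mul, integral_response_sq hω hγ hN]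
  ring

/-- The coherent channel converges to the positive ballistic value `T² c_∞/(2γ²)`. [folklore] -/
theorem harmonic_tendsto_integral_pairCorr_sq :
    Tendsto (fun N : ℕ => ∫ t in Ioi (0 : ℝ), (∫ z, z.2 0 * (∫ y, y.2 (Fin.last N)
        ∂((pinnedChain ω₂ 0 0 γ).transitionKernel (N + 1) T T t.toNNReal z))
        ∂((pinnedChain ω₂ 0 0 γ).gibbsMeasure (N + 1) T)) ^ 2)
      atTop (𝓝 (T ^ 2 * fluxLimit ω₂ γ / (2 * γ ^ 2))) := by
  have h1 : Tendsto (fun N : ℕ => fluxCoeff ω₂ γ (N + 1)) atTop (𝓝 (fluxLimit ω₂ γ)) :=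
    (tendsto_fluxCoeff hω hγ).comp (tendsto_add_atTop_nat 1)
  have h2 : Tendsto (fun N : ℕ => T ^ 2 * fluxCoeff ω₂ γ (N + 1) / (2 * γ ^ 2)) atTop
      (𝓝 (T ^ 2 * fluxLimit ω₂ γ / (2 * γ ^ 2))) :=
    (h1.const_mul (T ^ 2)).div_const (2 * γ ^ 2)
  refine h2.congr' ?_
  filter_upwards [eventually_ge_atTop 1] with N hN
  exact (harmonic_integral_pairCorr_sq hω hγ hT hN).symm

end Harmonic

/-- **`HarmonicCoherentPersistence` (item stmt-AtomisticToContinuum-11814), PROVED**: for the pinned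
harmonic chain `pinnedChain ω₂ 0 0 γ` (`ω₂, γ, T > 0`) the coherent channel does NOT close:
`t ↦ r_N(t)²` is integrable on `(0,∞)` for every `N`, and `N ∫₀^∞ r_N² ↛ 0` — indeed
`∫₀^∞ r_N² = T² c_{N+1}/(2γ²) → T² c_∞/(2γ²) > 0`, the Rieder–Lebowitz–Lieb / Nakazawa ballistic
conductance. [cite: RiederLebowitzLieb1967, results (i)-(ii) as restated in RoyDhar2008 §1] -/
theorem harmonicCoherentPersistence_proof : HarmonicCoherentPersistence := by
  intro ω₂ γ hω hγ T hT
  refine ⟨fun N => harmonic_integrableOn_pairCorr_sq hω hγ hT N, fun hlim => ?_⟩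
  have hb := tendsto_zero_of_tendsto_natMul_zero hlim
  have hb' := harmonic_tendsto_integral_pairCorr_sq hω hγ hT
  have heq := tendsto_nhds_unique hb hb'
  have hpos : 0 < T ^ 2 * fluxLimit ω₂ γ / (2 * γ ^ 2) := by
    have := fluxLimit_pos hω hγ
    positivity
  linarith

end Summit.AtomisticToContinuum.FouriersLaw.Theorems.HarmonicCoherentPersistence
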